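import Summits.ResolutionOfSingularities.ResolutionOfSingularities.Theorems.WeightedInvariantJOpenPresentationLE3Defs
import Summits.ResolutionOfSingularities.ResolutionOfSingularities.Theorems.WeightedInvariantHypersurfaceLocalGameEFT4SDimLETwoOpenClosedPoint
import Summits.ResolutionOfSingularities.ResolutionOfSingularities.Theorems.WeightedInvariantIota3EpsStrat
import Literature.AlgebraicGeometry.Resolution.StrictNormalCrossingsAt
import Literature.AlgebraicGeometry.Resolution.StrictNormalCrossingsDescent
import HarnessLib

/-!
# (open″)≤3 for the pair of record `(ι₃ᵗ, J₃ᵗ)` — THE ISOLATED POINT BODY (P₀₀) `JOpenLE3.PointBodyLE3 p 0 0`, from the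
# presentation of `J₃ᵗ` at `ε = 0` point-centre positions (door `HypersurfaceCentreConstruction`,
# stmt-ResolutionOfSingularities-19897; P3 rung clause h8 `JOpenPresentationForallSingLE 3 p Iota3.iotaFlatT Iota3.jFlatT`;
# input `hP00` of res-D-brk-1's regime assembly `JOpenLE3.jOpenPresentationForallSingLE_three_of`; DEAL (o52-Bε0) of
# res-L1-w43-plan-1 2026-08-27T18:54:37Z, hand res-D-pv-038)

Topic: `Summits/ResolutionOfSingularities/ResolutionOfSingularities/Theorems`. Helper for the door item
`HypersurfaceCentreConstruction` (stmt-ResolutionOfSingularities-19897, route `WeightedInvariant`), line `local-engine`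
(L W4.3), def-free.  At a model position `(A, 𝔪, F)` (`k₀` perfect of characteristic `p`, `A` of finite type, `A_𝔪`
regular of dimension `3`, `0 ≠ F/1 ∈ 𝔪² A_𝔪`) whose top `ι₀ = (ν ; ε ; τ)`-stratum is the closed point with
`(ε, τ) = (0, 0)` — an ISOLATED point — the literal ∃-body `JOpenLE3.JOpenBodyLE3 iotaFlatT jFlatT A 𝔪 F` holds AS SOON AS
`J₃ᵗ(A_𝔪, F/1)` is presented by a positively weighted minimal system of generators of `𝔪 A_𝔪` (hypothesis (σ-pres)₃
below).

THE ι-SIDE IS UNCONDITIONAL.  `ε = 0` makes the equimultiple locus `Σ(A_𝔪, F)` a permissible centre `V(P)`; along it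
`(ν ; ε)` is kept (res-type-013's `Iota3.isPermissibleEquimultipleLocus_localization`) and `τ` does not increase under
generization (`Iota3.iotaTau_localization_le`), so with `τ(𝔪) = 0` the whole of `V(P)` lies in the top `ι₀`-stratum,
which is the closed point: `P = 𝔪 A_𝔪`, i.e. `Σ(A_𝔪, F) = {𝔪}` (`IsolatedPoint.strat_iotaOrd_maximalIdeal`, the (strat)
conjunct for the ORDER function with centre the maximal ideal).  res-type-005's unconditional stratum iff for the order
function (`GenericEquimultiplicity.stratumIff_iotaOrd`, husc discharged) and res-type-073's `U`-bridge
(`StratumIff.stratumIff_forall_mem_of_comap_of_pos`) then give a basic open `D(h) ∋ 𝔪` on which, at primes of local dimension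
`≤ 3`, `(∀ i, U i ∈ 𝔮) ↔ (F ∈ 𝔪_{A_𝔮}² ∧ ι₃ᵗ(A_𝔮) F = ι₃ᵗ(A_𝔪) F)` — forward because `𝔮 = 𝔪` (heights,
`GenericEquimultiplicity.eq_of_le_of_ringKrullDim_le`), backward because `ι₃ᵗ`-equality forces `ν`-equality.  This is the
dimension-`3` transposition of res-type-005's dimension-`2` closed-point engine
`GenericEquimultiplicity.jOpenPresentationForallSingLE2_body_of_strat_maximalIdeal` (p516179), recorded here as
`JOpenLE3.jOpenBodyLE3_of_strat_maximalIdeal` for the pair of record.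

THE J-SIDE IS THE HYPOTHESIS (σ-pres)₃ — «at every position `S` regular local, essentially of finite type over a perfect field of
characteristic `p`, `dim S = 3`, `0 ≠ f ∈ 𝔪_S²`, top `ι₀`-stratum the closed point, `ε(S, f) = 0`, SOME positively weighted minimal
system of generators `u` of `𝔪_S` presents `J₃ᵗ`: `weightedMonomialIdeal u w m = jFlatT S f m` for all `m`» — the (pres)
sub-block of the rung's game clause `CanonicalGameClauseLE 3 p iotaFlatT jFlatT` (res-type-061, p522114) at these positions.  There
`jFlatT S f = Iota3.jSigmaPt S f` (res-type-061's `Iota3.jFlatT_eq_jSigmaPt`), the choice-free supremum of the two-flag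
filtrations of ALL σ-attaining primitive two-flags (res-type-061, `…Iota3JFlat`), so (σ-pres)₃ amounts to the ATTAINMENT of `σ` by an
admissible primitive two-flag together with the CANONICITY obligation (J-can) of IOTA3-DESIGN v1.2 §2.4 (res-type-070's OFFER
2026-08-27T12:06:54Z) and res-type-070's bridge `Iota3.flagContactFiltration_eq_weightedMonomialIdeal` (p533128) — none of which
is asserted here: the hypothesis is NAMED and carried, never discharged by assumption elsewhere.

* §1 `IsolatedPoint.strat_iotaOrd_maximalIdeal` — `Σ(S, f) = {𝔪}` at an `(ε, τ) = (0, 0)` point-centre position, as the (strat)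
  conjunct for `iotaOrd` with centre `𝔪_S`.
* §2 `IsolatedPoint.linearIndependent_toCotangent_of_span_eq` — a minimal system of generators has independent differentials
  (Literature `mem_maximalIdeal_of_sum_mul_rsop_mem_sq` in the subtype-free form of `JOpenBodyLE3`).
* §3 **`JOpenLE3.jOpenBodyLE3_of_strat_maximalIdeal`** — the dimension-`3` closed-point engine for `(iotaFlatT, jFlatT)`.
* §4 **`JOpenLE3.pointBodyLE3_zero_zero_of (hσ) : PointBodyLE3 p 0 0`**.

[OURS · L1 W4.3 · (o52-Bε0)]  Replaces the role of NO printed item; NOT a statement of the manuscript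
[claim: Hironaka2017, status: under-review]. AI work, weaker than expert review.  Pure commutative algebra; no named facts;
the one hypothesis (σ-pres)₃ is a CANDIDATE obligation of OUR line, spelled out in the theorem's signature.

## References

* V. Cossart, O. Piltant, *Resolution of singularities of threefolds in positive characteristic I*, J. Algebra 320 (2008),
  Prop. 4.2 (proof) (generic behaviour of the order along a regular prime). [CossartPiltant2008]
* H. Matsumura, *Commutative Ring Theory* (1987), Thm. 13.5 (heights), Thm. 14.2 (regular parameters). [Matsumura1987]
* res-L1-w43-plan-1, IOTA3-DESIGN v1.3 §8.4 (regime table) and DEAL (o52) SPLIT (OURS, AI planning); res-type-005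
  `…EFT4SDimLETwoOpenClosedPoint` (p516179), res-D-brk-1 `…JOpenPresentationLE3Defs` (p553420) (OURS, AI work).
-/

noncomputable section

open IsLocalRing Literature.AlgebraicGeometry.Resolution
open Summit.ResolutionOfSingularities.ResolutionOfSingularities.Cruxes.HypersurfaceCentreConstruction.LocalEngine
open Summit.ResolutionOfSingularities.ResolutionOfSingularities.Cruxes.HypersurfaceCentreConstruction.LocalEngine.Iota3

set_option linter.dupNamespace false -- mandated namespace of this single-conjunct summit

namespace Summit.ResolutionOfSingularities.ResolutionOfSingularities.Theorems

namespace IsolatedPoint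

open ContactCylinder

/-! ## §1 An `(ε, τ) = (0, 0)` point-centre position is an isolated equimultiple point -/

/-- **At an `(ε, τ) = (0, 0)` point-centre position the equimultiple locus is the closed point**, in (strat) form for the
order function with centre `𝔪_S`: for every prime `𝔭 ∋ f`, `ord_{S_𝔭} f = ord_S f ↔ 𝔪_S ≤ 𝔭`.  (`ε = 0`: `Σ(S, f) = V(P)`
is permissible; `(ν ; ε)` is kept at `P` (res-type-013) and `τ(S_P) ≤ τ(S) = 0`, so `P` lies in the top `ι₀`-stratum `{𝔪}`.)
[OURS · L1 W4.3 · (o52-Bε0)] -/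
theorem strat_iotaOrd_maximalIdeal {S : Type} [CommRing S] [IsLocalRing S] {f : S} (hf : f ∈ maximalIdeal S)
    (htop : topStratumPrime iotaOrdEpsTau S f = maximalIdeal S) (hε : iotaEps S f = 0) (hτ : iotaTau S f = 0)
    (𝔭 : Ideal S) [𝔭.IsPrime] (hf𝔭 : f ∈ 𝔭) :
    iotaOrd (Localization.AtPrime 𝔭) (algebraMap S (Localization.AtPrime 𝔭) f) = iotaOrd S f ↔ maximalIdeal S ≤ 𝔭 := by
  have hperm : IsPermissibleEquimultipleLocus S f := (iotaEps_eq_zero_iff S f).mp hε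
  obtain ⟨P, hP, -, hfP, hiff⟩ := (isPermissibleEquimultipleLocus_iff_strat S hf).mp hperm
  haveI := hP
  -- the permissible prime `P` lies in the top `ι₀`-stratum, hence is `𝔪`
  have hordP : iotaOrd (Localization.AtPrime P) (algebraMap S (Localization.AtPrime P) f) = iotaOrd S f :=
    (hiff P hfP).mpr le_rfl
  have hεP : iotaEps (Localization.AtPrime P) (algebraMap S (Localization.AtPrime P) f) = 0 :=
    (iotaEps_eq_zero_iff _ _).mpr (isPermissibleEquimultipleLocus_localization hf hperm P hfP hordP)
  have hτP : iotaTau (Localization.AtPrime P) (algebraMap S (Localization.AtPrime P) f) = 0 := by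
    have h := iotaTau_localization_le P f
    rw [hτ] at h
    exact nonpos_iff_eq_zero.mp h
  have h0 : iotaOrdEpsTau (Localization.AtPrime P) (algebraMap S (Localization.AtPrime P) f) = iotaOrdEpsTau S f :=
    (iotaOrdEpsTau_eq_iff _ _ _ _).mpr
      ⟨(iotaOrdEps_eq_iff _ _ _ _).mpr ⟨hordP, by rw [hεP, hε]⟩, by rw [hτP, hτ]⟩
  have hmem : (⟨P, hP⟩ : PrimeSpectrum S) ∈ topStratum iotaOrdEpsTau S f := h0
  have h𝔪P : maximalIdeal S ≤ P := by
    have hle := topStratumPrime_le iotaOrdEpsTau S f hmem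
    rwa [htop] at hle
  rw [hiff 𝔭 hf𝔭]
  exact ⟨fun hP𝔭 => h𝔪P.trans hP𝔭, fun h𝔪𝔭 => (IsLocalRing.le_maximalIdeal hP.ne_top).trans h𝔪𝔭⟩

/-! ## §2 Minimal systems of generators have independent differentials -/

/-- **A minimal system of generators of the maximal ideal of a regular local ring has independent differentials**
(subtype-free form matching the `∃ hU, LinearIndependent …` clause of `JOpenBodyLE3`). [cite: Matsumura1987, Thm. 14.2] -/
theorem linearIndependent_toCotangent_of_span_eq {S : Type} [CommRing S] [IsRegularLocalRing S] {N : ℕ} (u : Fin N → S)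
    (hspan : Ideal.span (Set.range u) = maximalIdeal S) (hN : (maximalIdeal S).spanFinrank = N)
    (hu : ∀ i, u i ∈ maximalIdeal S) :
    LinearIndependent (ResidueField S) (fun i => ((maximalIdeal S).toCotangent ⟨u i, hu i⟩ : CotangentSpace S)) :=
  (linearIndependent_toCotangent_iff_forall_mem u hu).mpr
    (fun c hc i => mem_maximalIdeal_of_sum_mul_rsop_mem_sq hN u hspan c hc i)

end IsolatedPoint

/-! ## §3 The dimension-three closed-point engine for the pair of record -/

namespace JOpenLE3

open ContactCylinder

/-- **(open″)≤3 AT A CLOSED-POINT CENTRE — engine for `(iotaFlatT, jFlatT)`.**  `k₀` perfect of characteristic `p`, `A` of finite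
type over `k₀`, `𝔪` a prime with `A_𝔪` regular of dimension `3`, `0 ≠ F/1 ∈ 𝔪² A_𝔪`.  Suppose (strat) holds for the ORDER
function at `A_𝔪` with centre the MAXIMAL IDEAL (`Σ(A_𝔪, F) = {𝔪}`), and `J₃ᵗ(A_𝔪)(F/1)` is presented by a positively weighted
system `xy` spanning `𝔪 A_𝔪` with independent differentials: `jFlatT (A_𝔪) (F/1) m = weightedMonomialIdeal xy W m`.  Then the
body `JOpenBodyLE3 iotaFlatT jFlatT A 𝔪 F` holds: `U` = numerators of `xy`; `h` from the order-function stratum iff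
(`GenericEquimultiplicity.stratumIff_iotaOrd`) and the `U`-bridge; `ι₃ᵗ`-equality forces `ν`-equality, and the presentation is
demanded only at the primes `𝔮 ⊇ 𝔪` of `D(h)` with `dim A_𝔮 ≤ 3`, i.e. at `𝔮 = 𝔪`.  Dimension-`3` transposition of res-type-005's
`GenericEquimultiplicity.jOpenPresentationForallSingLE2_body_of_strat_maximalIdeal`. [OURS · L1 W4.3 · (o52-B) engine]
[cite: CossartPiltant2008, Prop. 4.2 (proof)] -/
theorem jOpenBodyLE3_of_strat_maximalIdeal
    (k₀ : Type) [Field k₀] [PerfectField k₀]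
    (A : Type) [CommRing A] [Algebra k₀ A] [Algebra.FiniteType k₀ A] (𝔪 : Ideal A) [𝔪.IsPrime] (F : A)
    (hreg : IsRegularLocalRing (Localization.AtPrime 𝔪)) (hdim : ringKrullDim (Localization.AtPrime 𝔪) = (3 : ℕ))
    (hF0 : algebraMap A (Localization.AtPrime 𝔪) F ≠ 0)
    (hF2 : algebraMap A (Localization.AtPrime 𝔪) F ∈ (maximalIdeal (Localization.AtPrime 𝔪)) ^ 2)
    (hstrat : ∀ (𝔭 : Ideal (Localization.AtPrime 𝔪)) [𝔭.IsPrime],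
      algebraMap A (Localization.AtPrime 𝔪) F ∈ 𝔭 →
        (iotaOrd (Localization.AtPrime 𝔭) (algebraMap (Localization.AtPrime 𝔪) (Localization.AtPrime 𝔭)
            (algebraMap A (Localization.AtPrime 𝔪) F)) =
          iotaOrd (Localization.AtPrime 𝔪) (algebraMap A (Localization.AtPrime 𝔪) F) ↔
            maximalIdeal (Localization.AtPrime 𝔪) ≤ 𝔭))
    {N : ℕ} (xy : Fin N → Localization.AtPrime 𝔪) (W : Fin N → ℕ) (hW : ∀ i, 0 < W i)
    (hxy : ∀ i, xy i ∈ maximalIdeal (Localization.AtPrime 𝔪))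
    (hspan : Ideal.span (Set.range xy) = maximalIdeal (Localization.AtPrime 𝔪))
    (hli : LinearIndependent (ResidueField (Localization.AtPrime 𝔪))
      (fun i => ((maximalIdeal (Localization.AtPrime 𝔪)).toCotangent ⟨xy i, hxy i⟩ :
        CotangentSpace (Localization.AtPrime 𝔪))))
    (hJ : ∀ m : ℕ, jFlatT (Localization.AtPrime 𝔪) (algebraMap A (Localization.AtPrime 𝔪) F) m =
      weightedMonomialIdeal xy W m) :
    JOpenBodyLE3 iotaFlatT jFlatT A 𝔪 F := by
  classical
  haveI : IsNoetherianRing A := Algebra.FiniteType.isNoetherianRing k₀ A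
  haveI := hreg
  -- numerators of the system `xy`
  have hnum : ∀ i, ∃ (a : A) (s : 𝔪.primeCompl), algebraMap A (Localization.AtPrime 𝔪) a =
      algebraMap A (Localization.AtPrime 𝔪) (s : A) * xy i := fun i => by
    obtain ⟨⟨a, s⟩, has⟩ := IsLocalization.surj 𝔪.primeCompl (xy i)
    exact ⟨a, s, by rw [← has, mul_comm]⟩
  choose U s hUs using hnum
  have hsu : ∀ i, IsUnit (algebraMap A (Localization.AtPrime 𝔪) (s i : A)) := fun i =>
    IsLocalization.map_units (Localization.AtPrime 𝔪) (s i)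
  have hUm : ∀ i, algebraMap A (Localization.AtPrime 𝔪) (U i) ∈ maximalIdeal (Localization.AtPrime 𝔪) := fun i => by
    rw [hUs i]; exact Ideal.mul_mem_left _ _ (hxy i)
  -- same ideals: the span and the weighted monomial ideals
  have hspanU : Ideal.span (Set.range fun i => algebraMap A (Localization.AtPrime 𝔪) (U i)) =
      maximalIdeal (Localization.AtPrime 𝔪) := by
    apply le_antisymm
    · rw [Ideal.span_le]
      rintro _ ⟨i, rfl⟩
      exact hUm i
    · rw [← hspan, Ideal.span_le]
      rintro _ ⟨i, rfl⟩
      rw [SetLike.mem_coe, ← Ideal.unit_mul_mem_iff_mem _ (hsu i), ← hUs i]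
      exact Ideal.subset_span ⟨i, rfl⟩
  have hmapU : (Ideal.span {x | ∃ i, 0 < W i ∧ x = U i}).map (algebraMap A (Localization.AtPrime 𝔪)) =
      maximalIdeal (Localization.AtPrime 𝔪) := by
    rw [← hspanU, Ideal.map_span]
    congr 1
    ext z
    constructor
    · rintro ⟨_, ⟨i, -, rfl⟩, rfl⟩
      exact ⟨i, rfl⟩
    · rintro ⟨i, rfl⟩
      exact ⟨U i, ⟨i, hW i, rfl⟩, rfl⟩
  have hwmi : ∀ m, weightedMonomialIdeal (fun i => algebraMap A (Localization.AtPrime 𝔪) (U i)) W m =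
      weightedMonomialIdeal xy W m := fun m => by
    have : (fun i => algebraMap A (Localization.AtPrime 𝔪) (U i)) =
        fun i => algebraMap A (Localization.AtPrime 𝔪) (s i : A) * xy i := funext hUs
    rw [this, GenericEquimultiplicity.weightedMonomialIdeal_unit_mul xy _ hsu W m]
  -- linear independence of the cotangent images of the numerators
  have hliU : LinearIndependent (ResidueField (Localization.AtPrime 𝔪))
      (fun i => ((maximalIdeal (Localization.AtPrime 𝔪)).toCotangent
        ⟨algebraMap A (Localization.AtPrime 𝔪) (U i), hUm i⟩ : CotangentSpace (Localization.AtPrime 𝔪))) := by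
    have hne : ∀ i, residue (Localization.AtPrime 𝔪) (algebraMap A (Localization.AtPrime 𝔪) (s i : A)) ≠ 0 := fun i => by
      rw [ne_eq, residue_eq_zero_iff]
      exact fun h => (mem_nonunits_iff.mp ((IsLocalRing.mem_maximalIdeal _).mp h)) (hsu i)
    have h := hli.units_smul fun i => Units.mk0 _ (hne i)
    convert h using 1
    funext i
    rw [Pi.smul_apply', Units.smul_def, Units.val_mk0, ← ResidueField.algebraMap_eq, algebraMap_smul, ← map_smul]
    congr 1
    apply Subtype.ext
    change algebraMap A (Localization.AtPrime 𝔪) (U i) = _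
    rw [Submodule.coe_smul, smul_eq_mul, hUs i]
  -- (adm) for the centre `𝔪 A_𝔪`
  have hadm : ∀ (Q : Ideal (Localization.AtPrime 𝔪)) [Q.IsPrime], maximalIdeal (Localization.AtPrime 𝔪) ≤ Q →
      algebraMap (Localization.AtPrime 𝔪) (Localization.AtPrime Q) (algebraMap A (Localization.AtPrime 𝔪) F) ∈
        maximalIdeal (Localization.AtPrime Q) ^ 2 :=
    fun Q _ hQ => IotaOrderStrat.adm_maximalIdeal hF2 Q hQ
  -- the stratum iff for the order function (husc discharged) and the `U`-bridge
  have hiff := GenericEquimultiplicity.stratumIff_iotaOrd k₀ 𝔪 F hreg hF0 (maximalIdeal (Localization.AtPrime 𝔪))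
    (fun 𝔭 _ hF𝔭 => hstrat 𝔭 hF𝔭) hadm
  obtain ⟨h, hh, hU⟩ := StratumIff.stratumIff_forall_mem_of_comap_of_pos 𝔪 U W hW
    (maximalIdeal (Localization.AtPrime 𝔪)) hmapU
    (fun x => algebraMap A (Localization.AtPrime x.asIdeal) F ∈ maximalIdeal (Localization.AtPrime x.asIdeal) ^ 2 ∧
      iotaOrd (Localization.AtPrime x.asIdeal) (algebraMap A (Localization.AtPrime x.asIdeal) F) =
        iotaOrd (Localization.AtPrime 𝔪) (algebraMap A (Localization.AtPrime 𝔪) F)) hiff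
  have hcomap : (maximalIdeal (Localization.AtPrime 𝔪)).comap (algebraMap A (Localization.AtPrime 𝔪)) = 𝔪 :=
    Localization.AtPrime.under_maximalIdeal
  -- the bridge `span U ≤ 𝔮 ↔ 𝔪 ≤ 𝔮` on a basic open
  obtain ⟨h₂, hh₂, hbridge⟩ :=
    StratumIff.exists_forall_le_iff_comap_le 𝔪 (Ideal.span {x | ∃ i, 0 < W i ∧ x = U i})
  have h𝔪le : ∀ (𝔮 : Ideal A) [𝔮.IsPrime], h₂ ∉ 𝔮 → (∀ i, U i ∈ 𝔮) → 𝔪 ≤ 𝔮 := by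
    intro 𝔮 _ hh₂𝔮 hU𝔮
    have h1 : Ideal.span {x | ∃ i, 0 < W i ∧ x = U i} ≤ 𝔮 := by
      rw [Ideal.span_le]
      rintro _ ⟨i, -, rfl⟩
      exact hU𝔮 i
    have h2 := (hbridge 𝔮 hh₂𝔮).mp h1
    rwa [hmapU, hcomap] at h2
  refine ⟨h * h₂, fun hmem => (Ideal.IsPrime.mem_or_mem inferInstance hmem).elim hh hh₂, N, U, W, hW, ⟨hUm, hliU⟩,
    fun 𝔮 _ hh𝔮 hdim𝔮 => ?_⟩
  have hh𝔮' : h ∉ 𝔮 := fun h' => hh𝔮 (Ideal.mul_mem_right _ _ h')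
  have hh₂𝔮 : h₂ ∉ 𝔮 := fun h' => hh𝔮 (Ideal.mul_mem_left _ _ h')
  refine ⟨⟨fun hU𝔮 => ?_, fun hC => ?_⟩, fun hU𝔮 m => ?_⟩
  · -- `𝔪 ≤ 𝔮` and `dim A_𝔮 ≤ 3` force `𝔮 = 𝔪`
    have heq : 𝔪 = 𝔮 := GenericEquimultiplicity.eq_of_le_of_ringKrullDim_le (h𝔪le 𝔮 hh₂𝔮 hU𝔮) hdim hdim𝔮
    subst heq
    exact ⟨hF2, rfl⟩
  · -- `ι₃ᵗ`-equality forces `ν`-equality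
    refine (hU 𝔮 hh𝔮').mpr ⟨hC.1, ?_⟩
    have h1 := ((iotaFlatT_eq_iff _ _ _ _).mp hC.2).1
    have h2 := ((iotaOrdEpsTau_eq_iff _ _ _ _).mp h1).1
    exact ((iotaOrdEps_eq_iff _ _ _ _).mp h2).1
  · have heq : 𝔪 = 𝔮 := GenericEquimultiplicity.eq_of_le_of_ringKrullDim_le (h𝔪le 𝔮 hh₂𝔮 hU𝔮) hdim hdim𝔮
    subst heq
    rw [weightedMonomialIdeal_map, hwmi m, hJ m]

/-! ## §4 The isolated point body -/

/-- **THE ISOLATED POINT BODY (P₀₀) of the (open″)≤3 regime assembly, from the presentation of `J₃ᵗ` at `ε = 0` point-centre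
positions.**  Hypothesis (σ-pres)₃ (spelled out; = the (pres) sub-block of `CanonicalGameClauseLE 3 p iotaFlatT jFlatT` at the
dimension-`3` positions whose top `ι₀`-stratum is the closed point and whose letter is `ε = 0`; there `jFlatT = jSigmaPt`, so it is
σ-ATTAINMENT + (J-can) + the flag bridge — a candidate obligation of the line, NOT asserted): at every such position some positively
weighted minimal system of generators `u` of `𝔪_S` has `weightedMonomialIdeal u w m = jFlatT S f m` for all `m`.  Conclusion:
`JOpenLE3.PointBodyLE3 p 0 0` — at every model position `(A, 𝔪, F)` of dimension `3` with top `ι₀`-stratum the closed point and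
`(ε, τ) = (0, 0)`, the body `JOpenBodyLE3 iotaFlatT jFlatT A 𝔪 F` (ι-side unconditional: `Σ(A_𝔪, F) = {𝔪}`,
`IsolatedPoint.strat_iotaOrd_maximalIdeal`, and the engine `jOpenBodyLE3_of_strat_maximalIdeal`). [OURS · L1 W4.3 · (o52-Bε0)]
[cite: CossartPiltant2008, Prop. 4.2 (proof)] -/
theorem pointBodyLE3_zero_zero_of (p : ℕ)
    (hσ : ∀ (k₀ : Type) [Field k₀] [CharP k₀ p] [PerfectField k₀]
      (S : Type) [CommRing S] [Algebra k₀ S] [Algebra.EssFiniteType k₀ S] [IsRegularLocalRing S] (f : S),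
      ringKrullDim S = (3 : ℕ) → f ≠ 0 → f ∈ (maximalIdeal S) ^ 2 →
      topStratumPrime iotaOrdEpsTau S f = maximalIdeal S → iotaEps S f = 0 →
      ∃ (n : ℕ) (u : Fin n → S) (w : Fin n → ℕ),
        Ideal.span (Set.range u) = maximalIdeal S ∧ (maximalIdeal S).spanFinrank = n ∧ (∀ i, 0 < w i) ∧
        ∀ m : ℕ, weightedMonomialIdeal u w m = jFlatT S f m) :
    PointBodyLE3 p 0 0 := by
  intro k₀ _ _ _ A _ _ _ 𝔪 _ F hreg hdim hF0 hF2 htop hε hτ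
  haveI := hreg
  -- the presentation of `J₃ᵗ` at `S = A_𝔪` (hypothesis (σ-pres)₃)
  obtain ⟨n, u, w, hspan, hn, hw, hJ⟩ := hσ k₀ (Localization.AtPrime 𝔪) (algebraMap A (Localization.AtPrime 𝔪) F)
    hdim hF0 hF2 htop hε
  have hu : ∀ i, u i ∈ maximalIdeal (Localization.AtPrime 𝔪) := fun i => hspan ▸ Ideal.subset_span ⟨i, rfl⟩
  -- the ι-side: `Σ(A_𝔪, F) = {𝔪}`
  have hf : algebraMap A (Localization.AtPrime 𝔪) F ∈ maximalIdeal (Localization.AtPrime 𝔪) :=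
    Ideal.pow_le_self two_ne_zero hF2
  exact jOpenBodyLE3_of_strat_maximalIdeal k₀ A 𝔪 F hreg hdim hF0 hF2
    (fun 𝔭 _ hf𝔭 => IsolatedPoint.strat_iotaOrd_maximalIdeal hf htop hε hτ 𝔭 hf𝔭) u w hw hu hspan
    (IsolatedPoint.linearIndependent_toCotangent_of_span_eq u hspan hn hu) (fun m => (hJ m).symm)

end JOpenLE3

end Summit.ResolutionOfSingularities.ResolutionOfSingularities.Theorems

end
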